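import Literature.Analysis.FluidPDE.OnsagerBDSVCommutatorReduction
import Literature.Analysis.FluidPDE.OnsagerBDSVCommutatorZero
import Literature.Analysis.FluidPDE.OnsagerBDSVGluedStageAssembly
import HarnessLib

/-!
# Discharge of `BDSV.commutatorCZBound` (BDSV App. D, Prop. D.1) and of `BDSV.gluedTripleEstimates`

Buckmaster–De Lellis–Székelyhidi–Vicol, *Onsager's conjecture for admissible weak solutions*,
CPAM 72 (2019) 229–274 = arXiv:1701.08678, App. D, Prop. D.1 (a variant of Constantin 2015,
Lemma 1): for `α ∈ (0,1)`, `N ≥ 0`, a Calderón–Zygmund operator `T_K` and `b ∈ C^{N+1,α}(T³)`,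
`‖[T_K, b·∇]f‖_{N+α} ≲ ‖b‖_{1+α}‖f‖_{N+α} + ‖b‖_{N+1+α}‖f‖_α`. The named fact
`BDSV.commutatorCZBound` (`OnsagerBDSVPotentialTheory.lean`) transcribes it for the second Riesz
transforms `∂ᵢ∂ⱼΔ⁻¹`. Both halves of the printed proof are in the tree:

* the case `N = 0` ("precisely Lemma 1 in [Co2015]"), proved through the heat semigroup:
  `BDSV.commutator_rieszHessian_zero_le` (`OnsagerBDSVCommutatorZero.lean`);
* the case `N ≥ 1` from the case `N = 0` by the Leibniz rule and interpolation, "exactly as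
  printed": `BDSV.commutatorCZBound_of_order_zero` (`OnsagerBDSVCommutatorReduction.lean`).

This file composes them into the discharge `BDSV.commutatorCZBound_holds`, and records the
consequence announced in `OnsagerBDSVGluedStageAssembly.lean`: the glued-triple estimates of
BDSV §4 (Props. 4.3–4.4), `BDSV.gluedTripleEstimates_holds`, by the proved reduction
`BDSV.gluedTripleEstimates_of_commutatorCZBound`. Nothing new is asserted.

## References

* T. Buckmaster, C. De Lellis, L. Székelyhidi Jr., V. Vicol, *Onsager's conjecture for admissible
  weak solutions*, Comm. Pure Appl. Math. 72 (2019) 229–274 = arXiv:1701.08678, App. D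
  Prop. D.1 and its proof; §4, Props. 4.3–4.4. [`BuckmasterEtAl2018`]
* P. Constantin, *Lagrangian–Eulerian methods for uniqueness in hydrodynamic systems*, Adv. Math.
  278 (2015) 67–102, Lemma 1.
-/

namespace Literature.Analysis.FluidPDE

namespace BDSV

/-- **BDSV App. D, Prop. D.1 for `∂ᵢ∂ⱼΔ⁻¹` — discharge of `BDSV.commutatorCZBound`.** For
`0 < α < 1` and every `N` there is `C = C(α, N)` with
`‖∂ᵢ∂ⱼΔ⁻¹((b·∇)f) - (b·∇)∂ᵢ∂ⱼΔ⁻¹f‖_{C^{N,α}} ≤ C (‖b‖_{C^{1,α}}‖f‖_{C^{N,α}} + ‖b‖_{C^{N+1,α}}‖f‖_{C^{0,α}})`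
for all `i, j`, smooth vector fields `b` and smooth real `f` on `T³`. Printed: "Let `α ∈ (0,1)`
and `N ≥ 0` … Then `‖[T_K, b·∇]f‖_{N+α} ≲ ‖b‖_{1+α}‖f‖_{N+α} + ‖b‖_{N+1+α}‖f‖_α` … The case
`N = 0` is precisely Lemma 1 in [Co2015] … the case `N ≥ 1` … Leibniz rule … interpolation".
Proof: the order-zero estimate `BDSV.commutator_rieszHessian_zero_le` (heat semigroup) fed into
the printed induction `BDSV.commutatorCZBound_of_order_zero`.
[cite: BuckmasterEtAl2018, App. D Prop. D.1] -/
theorem commutatorCZBound_holds : commutatorCZBound :=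
  commutatorCZBound_of_order_zero fun _α hα0 hα1 => commutator_rieszHessian_zero_le hα0 hα1

/-- **The glued-triple estimates of BDSV §4 hold** (Props. 4.3–4.4: the bounds (4.6)–(4.8) on
the glued Reynolds stress and its material derivative), by the tree's reduction to the commutator
estimate of App. D (`BDSV.gluedTripleEstimates_of_commutatorCZBound`) and
`BDSV.commutatorCZBound_holds`. [cite: BuckmasterEtAl2018, §4 Props. 4.3–4.4; App. D Prop. D.1] -/
theorem gluedTripleEstimates_holds : gluedTripleEstimates :=
  gluedTripleEstimates_of_commutatorCZBound commutatorCZBound_holds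

end BDSV

end Literature.Analysis.FluidPDE
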